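import Mathlib
import Literature.Computability.AlgebraicComplexity.NestFreeMatchingPoly
import Summits.ValiantsHypothesis.ValiantsHypothesis.Theorems.FifoMatchingNNDivisionHardLinearTransport
import HarnessLib

/-!
# Route FifoMatching — crux `NNDivisionHard` (stmt-ValiantsHypothesis-21181): LOCAL COFACTORS reduce to a FACE of `NN_n`

Let `I` be any set of arc variables of `[0, 2n)` («local» arcs) avoided by at least one nest-free perfect matching.  In the
direction `𝟙_{I^c}` the top face of `NN_n` is the sub-sum `NN_n^{¬I}` over the nest-free perfect matchings with NO arc in
`I`, and a cofactor `h` all of whose variables lie in `I` has `𝟙_{I^c}`-weight `0` throughout.  The projection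
`x_e ↦ 1 (e ∈ I)` (free: Bürgisser 2000, Rem. 2.7) fixes `NN_n^{¬I}` and collapses `h` to a positive constant.  Hence:

* `weight_eq_card`, `weight_le`, `weight_eq_iff` — the `𝟙_{I^c}`-weight of a perfect matching is the number of its arcs
  outside `I` (`≤ n`, `= n` iff it avoids `I`);
* `topComponent_compl_eq` — `top_{𝟙_{I^c}}(NN_n) = NN_n^{¬I}` as soon as some nest-free perfect matching avoids `I`;
* `aeval_eq_self_of_vars` — a substitution fixing the variables of `q` fixes `q`;
* ★★ `complexity_avoidingFace_le_of_local` — **`I`-LOCAL COFACTORS: if every variable of `h ≠ 0` lies in `I`, then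
  `L₊(NN_n^{¬I}) ≤ L₊(NN_n · h) + 1`.**  A certificate with an `I`-local cofactor is at least as expensive as the
  `I`-avoiding face of `NN_n` itself;
* ★ `complexity_longFace_le_of_shortLocal` — instance `I` = the arcs of length `< ℓ₀` (`ℓ₀ ≤ n`; the shift matching
  `i ↦ i ± n` avoids them): **cofactors using only SHORT arcs reduce to the LONG-ARC FACE `NN_n^{≥ℓ₀}`** (nest-free perfect
  matchings all of whose arcs have length `≥ ℓ₀`).

READING for the residual programme of stmt-21181: the thick-queue measure behind `NNMonotoneExpBound.exp_lower_bound` is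
supported on matchings with all arcs long (queue padded by `U^L`), so a support-between form of
`SupportGenericExpBound.exp_lower_bound_of_support_eq` would make every short-arc-local cofactor (arcs of length `< L − m`,
of order `n^{2/3}`) — in particular every block-local cofactor such as the block products `Π_j ι_j(NN_β)`, which pass all the
by-name tiers of record — a non-certificate.  That export is NOT done here.  HONEST FRAMING: a reduction (face bookkeeping);
stmt-21181 stays OPEN; nothing here bears on `NNNotVP` or on VP ≠ VNP (NOT proved).
References: Bürgisser 2000 Rem. 2.7 [Burgisser2000]; Hrubeš–Yehudayoff 2021 §6 Problem 2 [HrubesYehudayoff2021].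
-/

noncomputable section

-- Sub = Summit single-conjunct layout: the duplicated namespace component is mandated by the tree.
set_option linter.dupNamespace false
set_option autoImplicit false

namespace Summit.ValiantsHypothesis.ValiantsHypothesis.Theorems.FifoMatching.NNDivisionHard.LocalCofactor

open Finset MvPolynomial Literature.Computability.AlgebraicComplexity
open Summit.ValiantsHypothesis.ValiantsHypothesis.Theorems.ZeroOneTransfer.Negative
  (topComponent topComponent_mul complexity_topComponent_le topComponent_ne_zero support_topComponent_subset)
open Summit.ValiantsHypothesis.ValiantsHypothesis.Theorems.FifoMatching.NNDivisionHard.StackPowersQueue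
  (topComponent_sum_arcMonomial shiftMatching shiftMatching_mem)
open Summit.ValiantsHypothesis.ValiantsHypothesis.Theorems.FifoMatching.NNDivisionHard.StackPowers
  (weight_arcExponent_eq_sum_openers)
open Summit.ValiantsHypothesis.ValiantsHypothesis.Theorems.FifoMatching.NNDivisionHard.LinearTransport
  (eval_one_ne_zero aeval_eq_C_of_support complexity_aeval_le_of_X_or_one)
open scoped NNReal BigOperators

variable {n : ℕ}

/-! ### §1 The direction `𝟙_{I^c}` and the `I`-avoiding face -/

/-- **Weight in the direction `𝟙_{I^c}`** = number of arcs outside `I`. [folklore] -/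
theorem weight_eq_card (I : Finset (Fin (2 * n) × Fin (2 * n))) (M : Fin (2 * n) → Fin (2 * n)) :
    Finsupp.weight (fun e : Fin (2 * n) × Fin (2 * n) => if e ∈ I then 0 else 1) (arcExponent M) =
      ((openers M).filter fun i => (i, M i) ∉ I).card := by
  rw [weight_arcExponent_eq_sum_openers, Finset.card_filter]
  refine Finset.sum_congr rfl fun i _ => ?_
  by_cases h : (i, M i) ∈ I <;> simp [h]

/-- Hence `≤ n` on perfect matchings. [folklore] -/
theorem weight_le (I : Finset (Fin (2 * n) × Fin (2 * n))) {M : Fin (2 * n) → Fin (2 * n)}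
    (hM : M ∈ perfectMatchings (2 * n)) :
    Finsupp.weight (fun e : Fin (2 * n) × Fin (2 * n) => if e ∈ I then 0 else 1) (arcExponent M) ≤ n := by
  rw [weight_eq_card]
  exact (Finset.card_filter_le _ _).trans (card_openers hM).le

/-- And `= n` iff the matching avoids `I`. [folklore] -/
theorem weight_eq_iff (I : Finset (Fin (2 * n) × Fin (2 * n))) {M : Fin (2 * n) → Fin (2 * n)}
    (hM : M ∈ perfectMatchings (2 * n)) :
    Finsupp.weight (fun e : Fin (2 * n) × Fin (2 * n) => if e ∈ I then 0 else 1) (arcExponent M) = n ↔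
      ∀ i ∈ openers M, (i, M i) ∉ I := by
  have hc := card_openers hM
  rw [weight_eq_card]
  constructor
  · intro h i hi
    have heq := Finset.eq_of_subset_of_card_le (Finset.filter_subset (fun i => (i, M i) ∉ I) (openers M))
      (by rw [h, hc])
    rw [← heq] at hi
    exact (Finset.mem_filter.1 hi).2
  · intro h
    rw [Finset.filter_true_of_mem h, hc]

/-- ★ **THE `I`-AVOIDING FACE: `top_{𝟙_{I^c}}(NN_n) = NN_n^{¬I}`** whenever some nest-free perfect matching avoids `I`.
[folklore] -/
theorem topComponent_compl_eq (I : Finset (Fin (2 * n) × Fin (2 * n)))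
    (hI : ∃ M ∈ nestFreeMatchings (2 * n), ∀ i ∈ openers M, (i, M i) ∉ I) :
    topComponent (fun e : Fin (2 * n) × Fin (2 * n) => if e ∈ I then 0 else 1) (nestFreeMatchingPoly n ℝ≥0) =
      ∑ M ∈ (nestFreeMatchings (2 * n)).filter (fun M => ∀ i ∈ openers M, (i, M i) ∉ I), arcMonomial ℝ≥0 M := by
  obtain ⟨M₀, hM₀, hM₀I⟩ := hI
  rw [nestFreeMatchingPoly_eq_sum_arcMonomial,
    topComponent_sum_arcMonomial _ nestFreeMatchings_subset_perfectMatchings (W := n)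
      (fun M hM => weight_le I (nestFreeMatchings_subset_perfectMatchings hM))
      ⟨M₀, hM₀, (weight_eq_iff I (nestFreeMatchings_subset_perfectMatchings hM₀)).2 hM₀I⟩]
  refine Finset.sum_congr (Finset.filter_congr fun M hM => ?_) fun _ _ => rfl
  exact weight_eq_iff I (nestFreeMatchings_subset_perfectMatchings hM)

/-! ### §2 Local cofactors -/

/-- A substitution fixing the variables of `q` fixes `q`. [folklore] -/
theorem aeval_eq_self_of_vars {σ : Type*} (a : σ → MvPolynomial σ ℝ≥0) {q : MvPolynomial σ ℝ≥0}
    (ha : ∀ e ∈ q.vars, a e = X e) : aeval a q = q := by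
  have := hom_congr_vars (f₁ := (aeval a : MvPolynomial σ ℝ≥0 →ₐ[ℝ≥0] MvPolynomial σ ℝ≥0).toRingHom)
    (f₂ := RingHom.id _) (p₁ := q) (p₂ := q) (by ext r; simp) (fun i hi _ => by simpa using ha i hi) rfl
  simpa using this

/-- ★★ **`I`-LOCAL COFACTORS.**  If some nest-free perfect matching avoids `I` and every variable of `h ≠ 0` lies in `I`,
then `L₊(NN_n^{¬I}) ≤ L₊(NN_n · h) + 1`. [cite: Burgisser2000, Rem. 2.7] -/
theorem complexity_avoidingFace_le_of_local (I : Finset (Fin (2 * n) × Fin (2 * n)))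
    (hI : ∃ M ∈ nestFreeMatchings (2 * n), ∀ i ∈ openers M, (i, M i) ∉ I)
    {h : MvPolynomial (Fin (2 * n) × Fin (2 * n)) ℝ≥0} (hh : h ≠ 0) (hloc : ∀ e ∈ h.vars, e ∈ I) :
    complexity (∑ M ∈ (nestFreeMatchings (2 * n)).filter (fun M => ∀ i ∈ openers M, (i, M i) ∉ I),
        arcMonomial ℝ≥0 M) ≤ complexity (nestFreeMatchingPoly n ℝ≥0 * h) + 1 := by
  classical
  set w : Fin (2 * n) × Fin (2 * n) → ℕ := fun e => if e ∈ I then 0 else 1 with hw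
  set F := ∑ M ∈ (nestFreeMatchings (2 * n)).filter (fun M => ∀ i ∈ openers M, (i, M i) ∉ I),
    arcMonomial ℝ≥0 M with hF
  let a : Fin (2 * n) × Fin (2 * n) → MvPolynomial (Fin (2 * n) × Fin (2 * n)) ℝ≥0 :=
    fun e => if e ∈ I then 1 else X e
  have ha : ∀ e, a e = X e ∨ a e = 1 := fun e => by by_cases he : e ∈ I <;> simp [a, he]
  have hK' : ∀ e, e ∉ ({e | e ∉ I} : Set _) → a e = 1 := fun e he => by
    have : e ∈ I := by simpa using he
    simp [a, this]
  -- the top component of the cofactor is `I`-local, hence collapses to a positive constant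
  have hq : topComponent w h ≠ 0 := topComponent_ne_zero w hh
  have hqloc : ∀ m ∈ (topComponent w h).support, ∀ e ∈ m.support, e ∉ ({e | e ∉ I} : Set _) := by
    intro m hm e he
    have hev : e ∈ h.vars := (mem_vars_iff_mem_support e).2 ⟨m, support_topComponent_subset w h hm, he⟩
    simpa using hloc e hev
  have hC : aeval a (topComponent w h) = C (eval (fun _ => (1 : ℝ≥0)) (topComponent w h)) :=
    aeval_eq_C_of_support {e | e ∉ I} a hK' hqloc
  have hκ : eval (fun _ => (1 : ℝ≥0)) (topComponent w h) ≠ 0 := eval_one_ne_zero hq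
  -- the face is fixed by the substitution
  have hface : topComponent w (nestFreeMatchingPoly n ℝ≥0) = F := topComponent_compl_eq I hI
  have hFfix : aeval a F = F := by
    refine aeval_eq_self_of_vars a fun e he => ?_
    obtain ⟨m, hm, hem⟩ := (mem_vars_iff_mem_support e).1 he
    rw [hF, support_sum_arcMonomial ((Finset.filter_subset _ _).trans nestFreeMatchings_subset_perfectMatchings),
      Finset.mem_image] at hm
    obtain ⟨M, hM, rfl⟩ := hm
    obtain ⟨-, hMI⟩ := Finset.mem_filter.1 hM
    -- `e` is an arc of `M`, hence not in `I`
    have he' : e ∉ I := by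
      obtain ⟨i, j⟩ := e
      have hij := Finsupp.mem_support_iff.1 hem
      rw [arcExponent_apply] at hij
      split_ifs at hij with hc
      · rw [← hc.2]; exact hMI i (mem_openers.2 hc.1)
      · exact absurd rfl hij
    simp [a, he']
  -- assemble
  have H1 : complexity (aeval a (topComponent w (nestFreeMatchingPoly n ℝ≥0 * h))) ≤
      complexity (nestFreeMatchingPoly n ℝ≥0 * h) :=
    (complexity_aeval_le_of_X_or_one a ha _).trans (complexity_topComponent_le w _)
  rw [topComponent_mul, hface, map_mul, hFfix, hC] at H1
  have H3 : F = (F * C (eval (fun _ => (1 : ℝ≥0)) (topComponent w h))) *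
      C (eval (fun _ => (1 : ℝ≥0)) (topComponent w h))⁻¹ := by
    rw [mul_assoc, ← C_mul, mul_inv_cancel₀ hκ, C_1, mul_one]
  calc complexity F = complexity ((F * C (eval (fun _ => (1 : ℝ≥0)) (topComponent w h))) *
        C (eval (fun _ => (1 : ℝ≥0)) (topComponent w h))⁻¹) := by rw [← H3]
    _ ≤ complexity (F * C (eval (fun _ => (1 : ℝ≥0)) (topComponent w h))) +
        complexity (C (eval (fun _ => (1 : ℝ≥0)) (topComponent w h))⁻¹ :
          MvPolynomial (Fin (2 * n) × Fin (2 * n)) ℝ≥0) + 1 := complexity_mul_le_holds _ _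
    _ = complexity (F * C (eval (fun _ => (1 : ℝ≥0)) (topComponent w h))) + 1 := by
        rw [complexity_C_holds, add_zero]
    _ ≤ complexity (nestFreeMatchingPoly n ℝ≥0 * h) + 1 := by gcongr

/-! ### §3 Short-arc-local cofactors and the long-arc face -/

/-- The shift matching `i ↦ i ± n` has all arcs of length exactly `n`, so it avoids the arcs of length `< ℓ₀ ≤ n`.
[folklore] -/
theorem shiftMatching_avoids_short {ℓ₀ : ℕ} (hℓ : ℓ₀ ≤ n) :
    ∀ i ∈ openers (shiftMatching n), (i, shiftMatching n i) ∉
      (univ : Finset (Fin (2 * n) × Fin (2 * n))).filter (fun e => (e.2 : ℕ) < (e.1 : ℕ) + ℓ₀) := by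
  intro i hi
  rw [mem_openers, Fin.lt_def] at hi
  rw [Finset.mem_filter, not_and]
  intro _
  simp only [shiftMatching] at hi ⊢
  split_ifs at hi ⊢ with h
  · omega
  · omega

/-- ★ **SHORT-ARC-LOCAL COFACTORS reduce to the LONG-ARC FACE.**  If every variable `x_(i,j)` of `h ≠ 0` is a short arc
(`j < i + ℓ₀`, `ℓ₀ ≤ n`), then `L₊(NN_n^{≥ℓ₀}) ≤ L₊(NN_n · h) + 1`, where `NN_n^{≥ℓ₀}` is the sum of the arc monomials of the
nest-free perfect matchings all of whose arcs have length `≥ ℓ₀`. [cite: Burgisser2000, Rem. 2.7]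
[cite: HrubesYehudayoff2021, §6 Problem 2] -/
theorem complexity_longFace_le_of_shortLocal {ℓ₀ : ℕ} (hℓ : ℓ₀ ≤ n)
    {h : MvPolynomial (Fin (2 * n) × Fin (2 * n)) ℝ≥0} (hh : h ≠ 0)
    (hshort : ∀ e ∈ h.vars, (e.2 : ℕ) < (e.1 : ℕ) + ℓ₀) :
    complexity (∑ M ∈ (nestFreeMatchings (2 * n)).filter (fun M => ∀ i ∈ openers M,
        (i, M i) ∉ (univ : Finset (Fin (2 * n) × Fin (2 * n))).filter (fun e => (e.2 : ℕ) < (e.1 : ℕ) + ℓ₀)),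
        arcMonomial ℝ≥0 M) ≤ complexity (nestFreeMatchingPoly n ℝ≥0 * h) + 1 :=
  complexity_avoidingFace_le_of_local _ ⟨shiftMatching n, shiftMatching_mem n, shiftMatching_avoids_short hℓ⟩ hh
    fun e he => Finset.mem_filter.2 ⟨Finset.mem_univ _, hshort e he⟩

end Summit.ValiantsHypothesis.ValiantsHypothesis.Theorems.FifoMatching.NNDivisionHard.LocalCofactor

end
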